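import Mathlib

/-!
# Spectral anti-screening ⇒ quasi-monotonicity (density caricature of crux `ScaleMonotonicity`, stmt-QuantumFields-27233)

Route `AntiScreeningCeilings` (ym-idea-11 g4), crux idea «spectral sub-homogeneity».  If the spectral measure of the plaquette channel has a
density `κ(E)·E⁷` with respect to `dE` whose scale-invariant profile `κ` is NON-INCREASING on `(0,∞)` (asymptotic freedom: the weight per unit
of free two-gluon phase space decreases with energy), then the Laplace transform `c(t) = ∫₀^∞ κ(E) E⁷ e^{-Et} dE` satisfies
`t⁸ c(t) ≤ t₂⁸ c(t₂)` for `0 < t ≤ t₂` — the crux's inequality with `A = 1`.  Proof: `t⁸ c(t) = ∫₀^∞ κ(u/t) u⁷ e^{-u} du` and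
`κ(u/t) ≤ κ(u/t₂)` pointwise.  Pure real analysis (Mathlib); nothing about Yang–Mills, the leaf, NT, UV or IR is asserted or proved.
-/

namespace Summit.QuantumFields.YangMills.Cruxes.ScaleMonotonicity.Spectral

open MeasureTheory Set Real

/-- the scale-invariant integrand after the substitution `u = E t`. -/
noncomputable def profile (κ : ℝ → ℝ) (t u : ℝ) : ℝ := κ (u / t) * u ^ 7 * Real.exp (-u)

/-- the substituted integrand is integrable on `(0,∞)` (dominated by `M·u⁷e^{-u}`, a Gamma integrand). -/
theorem profile_integrable (κ : ℝ → ℝ) (M : ℝ) (hmeas : Measurable κ) (hnn : ∀ x, 0 ≤ κ x) (hbd : ∀ x, κ x ≤ M)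
    (t : ℝ) : IntegrableOn (profile κ t) (Ioi 0) := by
  have hG : IntegrableOn (fun u : ℝ => Real.exp (-u) * u ^ (8 - 1 : ℝ)) (Ioi 0) :=
    Real.GammaIntegral_convergent (by norm_num : (0 : ℝ) < 8)
  have hG' : IntegrableOn (fun u : ℝ => M * (Real.exp (-u) * u ^ (8 - 1 : ℝ))) (Ioi 0) := hG.const_mul M
  refine Integrable.mono' hG' ?_ ?_
  · have : Measurable (profile κ t) := by
      unfold profile
      exact ((hmeas.comp (measurable_id.div_const t)).mul (measurable_id.pow_const 7)).mul
        (Real.measurable_exp.comp measurable_neg)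
    exact this.aestronglyMeasurable
  · refine (ae_restrict_iff' measurableSet_Ioi).mpr (Filter.Eventually.of_forall ?_)
    intro u hu
    have hu0 : 0 < u := hu
    have h7 : u ^ (8 - 1 : ℝ) = u ^ 7 := by
      rw [show (8 - 1 : ℝ) = (7 : ℕ) by norm_num, Real.rpow_natCast]
    rw [h7]
    unfold profile
    rw [Real.norm_eq_abs, abs_of_nonneg (by have := hnn (u / t); positivity)]
    have hk : κ (u / t) ≤ M := hbd _
    have hpos : 0 ≤ u ^ 7 * Real.exp (-u) := by positivity
    nlinarith

/-- the substitution `u = E·t`: `t⁸ · ∫₀^∞ κ(E) E⁷ e^{-Et} dE = ∫₀^∞ κ(u/t) u⁷ e^{-u} du`. -/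
theorem scaled_laplace_eq (κ : ℝ → ℝ) {t : ℝ} (ht : 0 < t) :
    t ^ 8 * ∫ E in Ioi 0, κ E * E ^ 7 * Real.exp (-(E * t)) = ∫ u in Ioi 0, profile κ t u := by
  have hsub := MeasureTheory.integral_comp_mul_left_Ioi (profile κ t) 0 ht
  rw [mul_zero] at hsub
  -- hsub : ∫ x in Ioi 0, profile κ t (t * x) = t⁻¹ • ∫ x in Ioi 0, profile κ t x
  have hpt : ∀ x : ℝ, profile κ t (t * x) = t ^ 7 * (κ x * x ^ 7 * Real.exp (-(x * t))) := by
    intro x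
    unfold profile
    rw [mul_div_cancel_left₀ x ht.ne', show -(x * t) = -(t * x) by ring]
    ring
  simp_rw [hpt] at hsub
  rw [integral_const_mul, smul_eq_mul] at hsub
  -- hsub : t ^ 7 * ∫ … = t⁻¹ * ∫ profile
  calc t ^ 8 * ∫ E in Ioi 0, κ E * E ^ 7 * Real.exp (-(E * t))
      = t * (t ^ 7 * ∫ E in Ioi 0, κ E * E ^ 7 * Real.exp (-(E * t))) := by ring
    _ = t * (t⁻¹ * ∫ u in Ioi 0, profile κ t u) := by rw [hsub]
    _ = ∫ u in Ioi 0, profile κ t u := by rw [← mul_assoc, mul_inv_cancel₀ ht.ne', one_mul]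

/-- DENSITY RUNG: a non-increasing scale-invariant spectral profile gives the crux's quasi-monotonicity with `A = 1`. -/
theorem densityMonotone (κ : ℝ → ℝ) (M : ℝ) (hmeas : Measurable κ) (hanti : AntitoneOn κ (Ioi 0))
    (hnn : ∀ x, 0 ≤ κ x) (hbd : ∀ x, κ x ≤ M) {t t₂ : ℝ} (ht : 0 < t) (htt : t ≤ t₂) :
    t ^ 8 * ∫ E in Ioi 0, κ E * E ^ 7 * Real.exp (-(E * t)) ≤
      t₂ ^ 8 * ∫ E in Ioi 0, κ E * E ^ 7 * Real.exp (-(E * t₂)) := by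
  have ht₂ : 0 < t₂ := lt_of_lt_of_le ht htt
  rw [scaled_laplace_eq κ ht, scaled_laplace_eq κ ht₂]
  refine setIntegral_mono_on (profile_integrable κ M hmeas hnn hbd t) (profile_integrable κ M hmeas hnn hbd t₂)
    measurableSet_Ioi ?_
  intro u hu
  have hu0 : 0 < u := hu
  unfold profile
  have hk : κ (u / t) ≤ κ (u / t₂) :=
    hanti (div_pos hu0 ht₂) (div_pos hu0 ht) (div_le_div_of_nonneg_left hu0.le ht htt)
  have hpos : 0 ≤ u ^ 7 * Real.exp (-u) := by positivity
  nlinarith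

end Summit.QuantumFields.YangMills.Cruxes.ScaleMonotonicity.Spectral
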